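import Mathlib
import HarnessLib

/-!
# Growth of `h⁰` from the Euler-characteristic inequalities of iterated hyperplane sections

The numerical skeleton of J.-P. Serre's proof of Théorème A / of the existence of sections of
`𝓜(m)` for `m ≫ 0` (*Faisceaux algébriques cohérents* (1955), n° 66 Thm. 2 with n° 81 Prop. 6;
*GAGA* (1956), n° 16 Lemme 8) and of D. Mumford, *Abelian Varieties* (1970), §16–17 ("the
Riemann–Roch theorem" by induction over hyperplane sections), with every vanishing theorem and
every duality replaced by monotone bookkeeping: if a sheaf `𝓕_n` on an `n`-fold and its iterated
hyperplane restrictions `𝓕_{n-1}, …, 𝓕_0` (`𝓕_j` supported in dimension `j`, `𝓕_0` a non-zero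
skyscraper) have finite `h⁰`, `h¹`, then the first six terms of the long exact sequences of
`0 → 𝓕_{j+1}(m) → 𝓕_{j+1}(m+1) → 𝓕_j(m+1) → 0` give, by rank–nullity (`finrank_six_term_le`),

  `h⁰_{j+1}(m) + h⁰_j(m+1) + h¹_{j+1}(m+1) ≤ h⁰_{j+1}(m+1) + h¹_{j+1}(m) + h¹_j(m+1)`,

i.e. `χ_{j+1}(m+1) ≥ χ_{j+1}(m) + χ_j(m+1)` for the truncated Euler characteristics
`χ_j = h⁰_j - h¹_j`; with `χ_0 ≥ 1` this forces `χ_j(m) ≥ 1` for `m ≫ 0` at every level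
(`eventually_pos_euler_of_inequalities`) and `h⁰_n(m) → ∞` for `n ≥ 1`
(`exists_lt_h0_of_euler_inequalities`); in particular `h⁰_n(m) > 0` for some `m`
(`exists_pos_h0_of_euler_inequalities`). The surface case (`n = 2`, two inequality systems) is
the tree's `Summit.HodgeConjecture.HodgeConjecture.Theorems.exists_lt_of_euler_inequalities`
(`NikulinTwinTransportLefschetzOneOneK3EulerCharacteristic`), whose `finrank_six_term_le` is
re-proved here in `Literature` so that literature proofs can use it.

Pure arithmetic and linear algebra; no geometry. Consumers: the dimension count of Serre's
theorem A for holomorphic line bundles in all dimensions (Kodaira–Serre sections,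
`Literature.AlgebraicGeometry.HodgeTheory.kodairaSerre_exists_globalSection_algebraicTwist`).

## References

* J.-P. Serre, *Faisceaux algébriques cohérents*, Ann. of Math. 61 (1955), n° 66, n° 81.
  [SerreFAC1955]
* J.-P. Serre, *Géométrie algébrique et géométrie analytique*, Ann. Inst. Fourier 6 (1956), n° 16
  Lemme 8. [SerreGAGA1956]
-/

namespace Literature.Algebra.Homology

open Module

/-! ### Rank–nullity along six terms of an exact sequence -/

section SixTerm

variable {K : Type*} [Field K]
  {V₀ V₁ V₂ V₃ V₄ V₅ : Type*}
  [AddCommGroup V₀] [Module K V₀]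
  [AddCommGroup V₁] [Module K V₁] [FiniteDimensional K V₁]
  [AddCommGroup V₂] [Module K V₂] [FiniteDimensional K V₂]
  [AddCommGroup V₃] [Module K V₃] [FiniteDimensional K V₃]
  [AddCommGroup V₄] [Module K V₄] [FiniteDimensional K V₄]
  [AddCommGroup V₅] [Module K V₅] [FiniteDimensional K V₅]

/-- **Rank–nullity along the first six terms of a long exact sequence.** For linear maps
`V₀ →a V₁ →b V₂ →c V₃ →d V₄ →e V₅` of finite-dimensional spaces with `a` injective and exactness
at `V₁, V₂, V₃, V₄`, one has `dim V₀ + dim V₂ + dim V₄ ≤ dim V₁ + dim V₃ + dim V₅`. With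
`V• = (H⁰(𝓕(m)), H⁰(𝓕(m+1)), H⁰(𝓕'(m+1)), H¹(𝓕(m)), H¹(𝓕(m+1)), H¹(𝓕'(m+1)))` for a short
exact sequence `0 → 𝓕(m) → 𝓕(m+1) → 𝓕'(m+1) → 0` this is the inequality
`χ(𝓕(m+1)) ≥ χ(𝓕(m)) + χ(𝓕'(m+1))` of truncated Euler characteristics `χ = h⁰ - h¹`.
(The same statement, in the `Summit` namespace, is
`NikulinTwinTransportLefschetzOneOneK3EulerCharacteristic.finrank_six_term_le`.) [folklore] -/
theorem finrank_six_term_le (a : V₀ →ₗ[K] V₁) (b : V₁ →ₗ[K] V₂) (c : V₂ →ₗ[K] V₃)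
    (d : V₃ →ₗ[K] V₄) (e : V₄ →ₗ[K] V₅) (ha : Function.Injective a) (hab : Function.Exact a b)
    (hbc : Function.Exact b c) (hcd : Function.Exact c d) (hde : Function.Exact d e) :
    finrank K V₀ + finrank K V₂ + finrank K V₄ ≤ finrank K V₁ + finrank K V₃ + finrank K V₅ := by
  have h₁ := b.finrank_range_add_finrank_ker
  have h₂ := c.finrank_range_add_finrank_ker
  have h₃ := d.finrank_range_add_finrank_ker
  have h₄ := e.finrank_range_add_finrank_ker
  rw [LinearMap.exact_iff] at hab hbc hcd hde
  rw [hab, LinearMap.finrank_range_of_inj ha] at h₁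
  rw [hbc] at h₂
  rw [hcd] at h₃
  rw [hde] at h₄
  have h₅ : finrank K (LinearMap.range e) ≤ finrank K V₅ := Submodule.finrank_le _
  omega

end SixTerm

/-! ### Growth from the iterated inequalities -/

/-- **Linear growth from unit increments**: if `f (m + 1) ≥ f m + 1` for all `m ≥ m₀` then
`f (m₀ + k) ≥ f m₀ + k`. [folklore] -/
theorem add_le_of_succ_ge {f : ℕ → ℤ} {m₀ : ℕ} (h : ∀ m, m₀ ≤ m → f m + 1 ≤ f (m + 1)) (k : ℕ) :
    f m₀ + k ≤ f (m₀ + k) := by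
  induction k with
  | zero => simp
  | succ k ih =>
    have h₁ := h (m₀ + k) (Nat.le_add_right _ _)
    rw [← Nat.add_assoc]
    push_cast
    omega

/-- **Eventual positivity of every truncated Euler characteristic.** Let `h⁰_j(m), h¹_j(m)`
(`j ≤ n`, `m ∈ ℕ`) be natural numbers with
`h⁰_{j+1}(m) + h⁰_j(m+1) + h¹_{j+1}(m+1) ≤ h⁰_{j+1}(m+1) + h¹_{j+1}(m) + h¹_j(m+1)` for all
`j < n` and all `m` (the six-term inequalities of the restriction sequences) and
`h¹_0(m) < h⁰_0(m)` for all `m` (the bottom level is a non-zero skyscraper: `χ_0 ≥ 1`). Then for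
every `j ≤ n` there is `m₀` with `h¹_j(m) < h⁰_j(m)` for all `m ≥ m₀`: indeed
`χ_{j+1}(m+1) - χ_{j+1}(m) ≥ χ_j(m+1) ≥ 1` eventually, so `χ_{j+1}` eventually increases by at
least one at each step. [cite: SerreGAGA1956, n° 16 Lemme 8 (dimension count)] -/
theorem eventually_pos_euler_of_inequalities (n : ℕ) (h0 h1 : ℕ → ℕ → ℕ)
    (hstep : ∀ j < n, ∀ m,
      h0 (j + 1) m + h0 j (m + 1) + h1 (j + 1) (m + 1) ≤ h0 (j + 1) (m + 1) + h1 (j + 1) m + h1 j (m + 1))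
    (hbase : ∀ m, h1 0 m < h0 0 m) :
    ∀ j ≤ n, ∃ m₀, ∀ m, m₀ ≤ m → h1 j m < h0 j m := by
  intro j
  induction j with
  | zero => exact fun _ ↦ ⟨0, fun m _ ↦ hbase m⟩
  | succ j ih =>
    intro hj
    obtain ⟨m₀, hm₀⟩ := ih (Nat.le_of_succ_le hj)
    -- the truncated Euler characteristic of level `j + 1`, in `ℤ` (kept opaque)
    obtain ⟨χ, hχ⟩ : ∃ χ : ℕ → ℤ, ∀ m, χ m = (h0 (j + 1) m : ℤ) - h1 (j + 1) m := ⟨_, fun _ ↦ rfl⟩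
    have hincr : ∀ m, m₀ ≤ m → χ m + 1 ≤ χ (m + 1) := fun m hm ↦ by
      have h₁ := hstep j (Nat.lt_of_succ_le hj) m
      have h₂ := hm₀ (m + 1) (Nat.le_succ_of_le hm)
      rw [hχ, hχ]
      omega
    obtain ⟨k₀, hk₀⟩ : ∃ k₀ : ℕ, 1 - χ m₀ ≤ k₀ := ⟨_, Int.self_le_toNat _⟩
    refine ⟨m₀ + k₀, fun m hm ↦ ?_⟩
    obtain ⟨k, rfl⟩ := Nat.exists_eq_add_of_le hm
    have h₁ := add_le_of_succ_ge hincr (k₀ + k)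
    rw [← Nat.add_assoc] at h₁
    have h₃ := hχ (m₀ + k₀ + k)
    push_cast at h₁
    omega

/-- **`h⁰` is unbounded at every positive level** under the six-term inequalities with a
non-zero bottom skyscraper (the dimension count of Serre's theorem A: `χ_n(m)` dominates an
arithmetic progression once `χ_{n-1} ≥ 1`, and `h⁰_n ≥ χ_n`). [cite: SerreGAGA1956, n° 16 Lemme 8 (dimension count)] -/
theorem exists_lt_h0_of_euler_inequalities {n : ℕ} (hn : 1 ≤ n) (h0 h1 : ℕ → ℕ → ℕ)
    (hstep : ∀ j < n, ∀ m,
      h0 (j + 1) m + h0 j (m + 1) + h1 (j + 1) (m + 1) ≤ h0 (j + 1) (m + 1) + h1 (j + 1) m + h1 j (m + 1))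
    (hbase : ∀ m, h1 0 m < h0 0 m) (B : ℕ) :
    ∃ m, B < h0 n m := by
  obtain ⟨n', rfl⟩ := Nat.exists_eq_add_of_le hn
  obtain ⟨m₀, hm₀⟩ := eventually_pos_euler_of_inequalities (1 + n') h0 h1 hstep hbase n' (by omega)
  obtain ⟨χ, hχ⟩ : ∃ χ : ℕ → ℤ, ∀ m, χ m = (h0 (n' + 1) m : ℤ) - h1 (n' + 1) m := ⟨_, fun _ ↦ rfl⟩
  have hincr : ∀ m, m₀ ≤ m → χ m + 1 ≤ χ (m + 1) := fun m hm ↦ by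
    have h₁ := hstep n' (by omega) m
    have h₂ := hm₀ (m + 1) (Nat.le_succ_of_le hm)
    rw [hχ, hχ]
    omega
  obtain ⟨k₀, hk₀⟩ : ∃ k₀ : ℕ, (B : ℤ) + 1 - χ m₀ ≤ k₀ := ⟨_, Int.self_le_toNat _⟩
  have hlin := add_le_of_succ_ge hincr k₀
  have h₃ := hχ (m₀ + k₀)
  refine ⟨m₀ + k₀, ?_⟩
  rw [Nat.add_comm 1 n']
  omega

/-- **Some twist has a non-zero `h⁰` at the top level** (all `n`, including `n = 0`): the form in
which the dimension count is consumed (existence of ONE non-zero section of `𝓕_n(m)`).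
[cite: SerreGAGA1956, n° 16 Lemme 8 (dimension count)] -/
theorem exists_pos_h0_of_euler_inequalities (n : ℕ) (h0 h1 : ℕ → ℕ → ℕ)
    (hstep : ∀ j < n, ∀ m,
      h0 (j + 1) m + h0 j (m + 1) + h1 (j + 1) (m + 1) ≤ h0 (j + 1) (m + 1) + h1 (j + 1) m + h1 j (m + 1))
    (hbase : ∀ m, h1 0 m < h0 0 m) :
    ∃ m, 0 < h0 n m := by
  obtain ⟨m₀, hm₀⟩ := eventually_pos_euler_of_inequalities n h0 h1 hstep hbase n le_rfl
  exact ⟨m₀, lt_of_le_of_lt (Nat.zero_le _) (hm₀ m₀ le_rfl)⟩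

end Literature.Algebra.Homology
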